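import Mathlib

/-!
# The roll Doppler lattice is diagonalised by Gegenbauer (`λ = 2`) trigonometric eigenfunctions (solo-blind kernel #186)

Paper `steady-zeroth-law.md` §24.107 / PLAN §107.  In the ideal leaf chain the `O(P)` Doppler part of the ROLL block is the lattice
`(J ρ)_m = ((m+2)/(m+1)) ρ_{m+1} + ((m-2)/(m-1)) ρ_{m-1}` (`m ≥ 2`; the coefficient of `ρ₁` in the `ρ₂`-row vanishes, so `r₂` is an
edge and `r₁` is Doppler-immune), while the STREAK block is the free lattice `σ_{m+1} + σ_{m-1}` (cosine basis).  Both are, exactly, the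
multiplication operator `2 cos ϑ` in an explicit trigonometric basis.  For the streaks this is `cos((m+1)ϑ) + cos((m-1)ϑ) = 2 cos ϑ cos(mϑ)`;
for the rolls the generalised eigenvector is

  `ρ_m(ϑ) = p_m(ϑ) / (m² - 1)`,  `p_m(ϑ) := (m+1) sin((m-1)ϑ) - (m-1) sin((m+1)ϑ)`  (`= 4 sin³ϑ · C^{(2)}_{m-2}(cos ϑ)`, Gegenbauer),

and the content is the division-free three-term identity `(m-1) p_{m+1} + (m+1) p_{m-1} = 2 m cos ϑ · p_m` (all real `m`), the edge
condition `p_1 = 0` and the normalisation `p_2 = 4 sin³ϑ ≠ 0` on `(0, π)`.  (After the diagonal similarity the lattice is the Jacobi matrix of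
`sin²ϑ C^{(2)}_{m-2}(cos ϑ)`, orthonormal in `L²(0,π)` as `p_m /(sin ϑ √(2π(m²-1)))`, the Pöschl–Teller eigenfunctions `-ψ'' + 2ψ/sin²ϑ = m²ψ`.)
Consequence used by the outer theorem: every roll-lattice propagator matrix element `⟨e_m, e^{iφJ} e_n⟩` is an explicit trigonometric
oscillatory integral with phase `2φ cos ϑ` whose amplitude vanishes to fourth order at the stationary points `ϑ = 0, π` (edge return `∝ φ^{-5/2}`).

* `streakEigen_rec` — the cosine-basis identity for the streak lattice;
* `rollEigen_one`, `rollEigen_two` — edge condition and normalisation;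
* `rollEigen_rec` — the division-free recurrence for all real `m`;
* `rollLattice_eigen` — the lattice form `((m+2)/(m+1)) ρ_{m+1} + ((m-2)/(m-1)) ρ_{m-1} = 2 cos ϑ ρ_m` for real `m ∉ {0, ±1, ±2}`,
  and `rollLattice_eigen_edge` — the `m = 2` row (where the `ρ₁` coefficient is `0`).
-/

namespace Summit.AnomalousDissipation.AnomalousDissipation.Theorems

open Real

/-- Streak lattice (free chain, cosine basis): `cos((m+1)ϑ) + cos((m-1)ϑ) = 2 cos ϑ cos(mϑ)`. -/
theorem streakEigen_rec (m ϑ : ℝ) :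
    cos ((m + 1) * ϑ) + cos ((m - 1) * ϑ) = 2 * cos ϑ * cos (m * ϑ) := by
  rw [show (m + 1) * ϑ = m * ϑ + ϑ by ring, show (m - 1) * ϑ = m * ϑ - ϑ by ring, cos_add, cos_sub]; ring

/-- The trigonometric roll-lattice eigenfunction numerator `p_m(ϑ) = (m+1) sin((m-1)ϑ) - (m-1) sin((m+1)ϑ)`. -/
noncomputable def rollEigen (m ϑ : ℝ) : ℝ := (m + 1) * sin ((m - 1) * ϑ) - (m - 1) * sin ((m + 1) * ϑ)

/-- Edge condition: `p_1 = 0` (the `ρ₂`-row of the lattice does not see `ρ₁`). -/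
theorem rollEigen_one (ϑ : ℝ) : rollEigen 1 ϑ = 0 := by simp [rollEigen]

/-- Normalisation: `p_2 = 3 sin ϑ - sin 3ϑ = 4 sin³ϑ`. -/
theorem rollEigen_two (ϑ : ℝ) : rollEigen 2 ϑ = 4 * sin ϑ ^ 3 := by
  have h3 : sin (3 * ϑ) = 3 * sin ϑ - 4 * sin ϑ ^ 3 := sin_three_mul ϑ
  simp only [rollEigen]
  rw [show ((2:ℝ) - 1) * ϑ = ϑ by ring, show ((2:ℝ) + 1) * ϑ = 3 * ϑ by ring, h3]; ring

/-- **Division-free three-term recurrence** `(m-1) p_{m+1} + (m+1) p_{m-1} = 2 m cos ϑ p_m`, valid for every real `m`. -/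
theorem rollEigen_rec (m ϑ : ℝ) :
    (m - 1) * rollEigen (m + 1) ϑ + (m + 1) * rollEigen (m - 1) ϑ = 2 * m * cos ϑ * rollEigen m ϑ := by
  have hA : sin ((m + 1 + 1) * ϑ) = sin (m * ϑ) * cos (2 * ϑ) + cos (m * ϑ) * sin (2 * ϑ) := by
    rw [show (m + 1 + 1) * ϑ = m * ϑ + 2 * ϑ by ring, sin_add]
  have hB : sin ((m + 1 - 1) * ϑ) = sin (m * ϑ) := by rw [show (m + 1 - 1) * ϑ = m * ϑ by ring]
  have hC : sin ((m - 1 + 1) * ϑ) = sin (m * ϑ) := by rw [show (m - 1 + 1) * ϑ = m * ϑ by ring]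
  have hD : sin ((m - 1 - 1) * ϑ) = sin (m * ϑ) * cos (2 * ϑ) - cos (m * ϑ) * sin (2 * ϑ) := by
    rw [show (m - 1 - 1) * ϑ = m * ϑ - 2 * ϑ by ring, sin_sub]
  have hE : sin ((m - 1) * ϑ) = sin (m * ϑ) * cos ϑ - cos (m * ϑ) * sin ϑ := by
    rw [show (m - 1) * ϑ = m * ϑ - ϑ by ring, sin_sub]
  have hF : sin ((m + 1) * ϑ) = sin (m * ϑ) * cos ϑ + cos (m * ϑ) * sin ϑ := by
    rw [show (m + 1) * ϑ = m * ϑ + ϑ by ring, sin_add]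
  simp only [rollEigen]
  rw [hA, hB, hC, hD, hE, hF, cos_two_mul, sin_two_mul]; ring

/-- The roll generalised eigenvector `ρ_m(ϑ) = p_m(ϑ)/(m² - 1)` (so that `ρ₂ = 4 sin³ϑ / 3`; any common `ϑ`-factor is allowed). -/
noncomputable def rollRho (m ϑ : ℝ) : ℝ := rollEigen m ϑ / (m ^ 2 - 1)

/-- **Lattice form** of the recurrence: `((m+2)/(m+1)) ρ_{m+1} + ((m-2)/(m-1)) ρ_{m-1} = 2 cos ϑ ρ_m` for real `m ∉ {0, ±1, ±2}`
(all naturals `m ≥ 3`; the `m = 2` row is `rollLattice_eigen_edge`). -/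
theorem rollLattice_eigen (m ϑ : ℝ) (h0 : m ≠ 0) (h1 : m ≠ 1) (h1' : m ≠ -1) (h2 : m ≠ 2) (h2' : m ≠ -2) :
    (m + 2) / (m + 1) * rollRho (m + 1) ϑ + (m - 2) / (m - 1) * rollRho (m - 1) ϑ = 2 * cos ϑ * rollRho m ϑ := by
  have hrec := rollEigen_rec m ϑ
  have d1 : m + 1 ≠ 0 := fun h => h1' (by linarith)
  have d2 : m - 1 ≠ 0 := fun h => h1 (by linarith)
  have d3 : m + 2 ≠ 0 := fun h => h2' (by linarith)
  have d4 : m - 2 ≠ 0 := fun h => h2 (by linarith)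
  unfold rollRho
  have H : (m + 2) / (m + 1) * (rollEigen (m + 1) ϑ / ((m + 1) ^ 2 - 1))
      + (m - 2) / (m - 1) * (rollEigen (m - 1) ϑ / ((m - 1) ^ 2 - 1)) - 2 * cos ϑ * (rollEigen m ϑ / (m ^ 2 - 1))
      = ((m - 1) * rollEigen (m + 1) ϑ + (m + 1) * rollEigen (m - 1) ϑ - 2 * m * cos ϑ * rollEigen m ϑ)
        / (m * (m - 1) * (m + 1)) := by
    have e1 : (m + 1) ^ 2 - 1 = m * (m + 2) := by ring
    have e2 : (m - 1) ^ 2 - 1 = m * (m - 2) := by ring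
    have e3 : m ^ 2 - 1 = (m - 1) * (m + 1) := by ring
    rw [e1, e2, e3]
    field_simp
  rw [hrec, sub_self, zero_div] at H
  exact sub_eq_zero.mp H

/-- The edge row `m = 2`: the coefficient `(m-2)/(m-1)` of `ρ₁` vanishes and `(4/3) ρ₃ = 2 cos ϑ ρ₂`. -/
theorem rollLattice_eigen_edge (ϑ : ℝ) : (4 / 3 : ℝ) * rollRho 3 ϑ = 2 * cos ϑ * rollRho 2 ϑ := by
  have hrec := rollEigen_rec 2 ϑ
  rw [show (2:ℝ) - 1 = 1 by norm_num, rollEigen_one, show (2:ℝ) + 1 = 3 by norm_num] at hrec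
  simp only [rollRho]
  norm_num
  linear_combination (1 / 6 : ℝ) * hrec

end Summit.AnomalousDissipation.AnomalousDissipation.Theorems
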